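import Summits.QuantumFields.BalabanUV.T4Continuum.Support.NE7ApeCurvedRepRoadBH
import Summits.QuantumFields.BalabanUV.T4Continuum.Support.NE7SameTopNormalLift
import HarnessLib

/-!
# NE7ApeCurvedRepRoadBLiftedH — TWIN (t4-ne7-p1 gen 80) of `NE7ApeCurvedRepRoadBLifted` with the slice-solver letter in the HOMOGENEOUS TWO-TERM shape (L2)ʰ `‖curlAt W X‖ ≤ K_G·g + K_X·R` (`R` a sup bound of `X`)
# and the normal part's sup bound `a_N` displayed; conclusion radius gains `+ K_X·(α₀ + a_N)` next to `c_N`.  WHY: the one-term letter of the original (with `hS ⊇ tangent` downstream)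
# is UNSATISFIABLE at curved data (F128 `NE7SliceLetterGaugeObstruction`, F130 `NE7SliceLetterConstantFluxWitness`); (L2)ʰ is consistent at every background (trivially with
# `K_G = 0`, `K_X = 4`) and its content is the size of `(K_G, K_X)`.  Memo `t4/b2b-balaban-t4-ne7-p1-g80/SLICE-LETTER-OBSTRUCTION.md` §3.  Everything else VERBATIM from the original
# (whose header follows); HONEST FRAMING as there: composition over displayed letters, nothing of Bałaban's asserted, (APE) on curved data NOT proved, NOT NE7, spine 0∕9, NOT Clay.
-/

/-!
# NE7ApeCurvedRepRoadBLifted — ROAD (B) WITH (L1)′ DISCHARGED: the curved (APE) with a datum at a tangent-critical background ⇐ E′'s REGIME + α₁ (the gradient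
# member of the same-top structured fields) + (L2) (the slice solver on a set `S` containing the `W`-tangent skew periodic fields) — F110 with its letter `hNlift`
# supplied by F111 (`c_N = 4m`, `ν = 24·#Plane·m`, `m = supC∕(M(1−θ))·4(3+12d)³∕ρ₀²·(Mα₀)²`, second order); file 43

Cell `pub-balaban`, rung (B)+1 sub-cell t4, lineage `b2b-balaban-t4-ne7-p1` (CRUX PROVER NE7 #1 = OWNER of row NE7), generation 78; memo
`t4/b2b-balaban-t4-ne7-p1-g78/BUMP-CLASS-FLAT.md` §7.  File F112 (over F110 `NE7ApeCurvedRepRoadB.smallField_of_tanCritical_roadB`, F111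
`NE7SameTopNormalLift.exists_normalLift_sameTop`, `NE3ResidualSliceRep.dirIter_sub`).
WHY.  F110 displayed three analytic letters: (L1)′ `hNlift`, α₁ `hGrad`, (L2) `hG`.  F111 proved the analytic conjuncts of (L1)′ for every same-top field; the
remaining conjunct `Z′ − AN ∈ S` is bookkeeping once `S` contains the `W`-tangent skew periodic fields (hypothesis `hS`; the natural slice of (L2)).  THIS FILE
substitutes F111 into F110: the curved (APE) with a datum on road (B) now rests on E′'s regime (PROVED representative), three more regime lines for the quadratic
remainder (`LevelSmall (j+1)`, `curvSum (j+1) x ≤ 2L∕3`, `4(3+12d)²·M·α₀ ≤ ρ₀²`), and exactly TWO analytic letters: α₁ and (L2).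
WHAT ([folklore]; 0 def, 0 sorry).  **`smallField_of_tanCritical_roadB_lifted`** — F78's conclusion (radius at `α₀`, with `c_N = 4m`, `ν = 24·#Plane·m`).
HONEST FRAMING (page 1): composition; α₁ and (L2) are HYPOTHESES; nothing of Bałaban's asserted; (APE) on curved data NOT proved; NOT ONE-STEP, NOT NE7; spine 0∕9;
finite T⁴ rung (B)+1 — NOT infinite volume, NOT mass gap, NOT `BetaPertH`, NOT Clay.  Continuum YM on T⁴ ⇐ BetaPertH ∧ nine spine estimates (0/9 proved); BetaPertH ⇐
(D1) ∧ (D4) ∧ CAP+tail; G-an2-4 gates asym, D1 and NE2/3/4.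
-/

set_option autoImplicit false

open scoped BigOperators Matrix Matrix.Norms.L2Operator
open NormedSpace Finset

namespace Summit.QuantumFields.BalabanUV.T4Continuum.NE7ApeCurvedRepRoadBLiftedH

open Literature.MathematicalPhysics.QuantumFieldTheory.Balaban1983to89
open B7Prop1Explicit B7Prop2Explicit MatrixLog UnitaryModel
open T4AveragingDeficitWall (Ad IsUnitaryCfg IsSkewDir SmallField vary curlAt dirL1)
open T4AveragingDeficitWallBoundary (IsPeriodicCfg periodBox)
open AveragingDeficitPeriodicCounting (IsPeriodicDir)
open AveragingDeficitTwoLevelPrep (twoLevelSmall)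
open AveragingDeficitMultiLevelPrep (cavgIter LevelSmall)
open MinimalActionLevels (perWin)
open BlockAverageVaryHolo (nbRad)
open BlockAveragePushDirGauge (gaugeDir)
open NE3HessForm (hess dAction)
open NE3TangentCovariantTower (dirIter)
open NE3EnergyShapes (IsUnitarySite IsPeriodicSite)
open NE3CovariantWeitzenbock (covDiv)
open NE3RightInverseSupLetters (frameC)
open NE3QbarIterCovLiftPrep (cruxC)
open NE3RightInverseSolveLetters (thetaLoc)
open NE3HatInvCurlLetters (curl1C)
open NE3.PairLandauB8 (IsLandauB8)
open BlockAverageVaryDisc (rho0)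
open NE3LinearisedAverageSup (curvSum)
open NE3RightInverseSupLetters (supC)
open NE3RightInverseSolveLetters (cruxC_nonneg)
open NE3ResidualSliceRep (dirIter_sub)
open NE7ApeCurvedRepRoadBH (smallField_of_tanCritical_roadB)
open NE7SameTopNormalLift (exists_normalLift_sameTop)

noncomputable section

variable {d : ℕ} {n : Type*} [Fintype n] [DecidableEq n]

/-- **ROAD (B) WITH (L1)′ DISCHARGED** (statement in the module docstring). [folklore] -/
theorem smallField_of_tanCritical_roadB_lifted [Nonempty n] (hd : 2 ≤ d) {L N : ℕ} [NeZero N] (hL : 2 ≤ L) (j : ℕ)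
    -- the background
    {W : Site d → Fin d → (Matrix n n ℂ)ˣ} {x : ℝ} (hWu : IsUnitaryCfg W) (hWP : IsPeriodicCfg W ((N * L ^ (j + 1) : ℕ) : ℤ))
    (hx : 0 ≤ x) (hs : LevelSmall d L j x) (hWx : SmallField W x)
    -- the sup radius of the representative and the regime at `x′ = x + 4(e^{α₀} − 1)`
    {α₀ : ℝ} (hα0 : 0 ≤ α₀) (hs' : LevelSmall d L j (x + 4 * (Real.exp α₀ - 1)))
    (hθ : cruxC d L * (((L : ℝ) ^ (j + 1)) ^ 2 * (x + 4 * (Real.exp α₀ - 1))) < 1)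
    (hθl : thetaLoc d L * (((L : ℝ) ^ (j + 1)) ^ 2 * (x + 4 * (Real.exp α₀ - 1))) < 1)
    (hε : ((L : ℝ) ^ (j + 1)) ^ 2 * (x + 4 * (Real.exp α₀ - 1)) ≤ 1)
    -- the field: of the class, tangent-critical, over `W`'s datum
    {U : Site d → Fin d → (Matrix n n ℂ)ˣ} (hUu : IsUnitaryCfg U) (hUP : IsPeriodicCfg U ((N * L ^ (j + 1) : ℕ) : ℤ))
    {xU : ℝ} (hxU : 0 ≤ xU) (hsU : LevelSmall d L j xU) (hUxU : SmallField U xU)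
    (hcritU : ∀ Y : Site d → Fin d → Matrix n n ℂ, IsSkewDir Y → IsPeriodicDir Y ((N * L ^ (j + 1) : ℕ) : ℤ) →
      dirIter L (j + 1) U Y = 0 → dAction U Y (perWin d (N * L ^ (j + 1))) = 0)
    (hTopUW : cavgIter L (j + 1) U = cavgIter L (j + 1) W)
    -- row NE3's class data of `W` and E′'s initial gauge ∕ regime (as in `exists_landauRep_W`), the constant `c_RE` named; road (B)'s two extra regime lines
    {x₁ : ℝ} (hx10 : 0 ≤ x₁)
    (hgrad : ∀ (p : Site d) (μ κ : Fin d), κ ≠ μ →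
      ‖Ad (W p μ) ((hol W (p + e μ) (plaqWord κ μ) : (Matrix n n ℂ)ˣ) : Matrix n n ℂ) - ((hol W p (plaqWord κ μ) : (Matrix n n ℂ)ˣ) : Matrix n n ℂ)‖ ≤ x₁)
    (hbx : 23040 * (d : ℝ) ^ 4 * (frameC d L + d) ^ 2 * ((L : ℝ) ^ (j + 1)) ^ 2 * x ≤ 1)
    (hcx : 11520 * (d : ℝ) ^ 4 * (frameC d L + d) ^ 3 * ((L : ℝ) ^ (j + 1)) ^ 3 * x₁ ≤ 1)
    (hbx' : 256 * (d : ℝ) ^ 2 * ((L : ℝ) ^ (j + 1)) ^ 2 * x ≤ 1) (hcx' : 16 * (d : ℝ) * ((L : ℝ) ^ (j + 1)) ^ 3 * x₁ ≤ 1)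
    {r₀ b₀ : ℝ} (hr₀ : ∀ (y : Site d) (μ : Fin d), ‖(((W y μ)⁻¹ * U y μ : (Matrix n n ℂ)ˣ) : (Matrix n n ℂ)) - 1‖ ≤ r₀)
    (hb₀ : ∀ x : Site d, ‖covDiv W (fun y μ => mlog (((W y μ)⁻¹ * U y μ : (Matrix n n ℂ)ˣ) : (Matrix n n ℂ))) x‖ ≤ b₀)
    {cRE : ℝ} (hcRE : cRE = 1 + 2 * (Fintype.card n : ℝ) * (64 * (d : ℝ) ^ 2 * N) ^ d + 27 * (Fintype.card n : ℝ) ^ 3 * (512 : ℝ) ^ d * (N : ℝ) ^ d)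
    (hreg₁ : (36 * (d : ℝ) * (frameC d L + d) ^ 2) * ((L : ℝ) ^ (j + 1)) ^ 2 * (cRE * b₀) ≤ 1 / 10)
    (hreg₂ : (36 * (d : ℝ) * (frameC d L + d)) * (L : ℝ) ^ (j + 1) * (cRE * b₀) ≤ 1 / 25)
    (hreg₃ : r₀ + 5 / 2 * ((36 * (d : ℝ) * (frameC d L + d)) * (L : ℝ) ^ (j + 1) * (cRE * b₀)) ≤ 1 / 20)
    (hline : cRE * (4 * ((36 * (d : ℝ) * (frameC d L + d) ^ 2) * ((L : ℝ) ^ (j + 1)) ^ 2) * (b₀ + 4 * (cRE * b₀))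
        + 25 * d * (r₀ + 5 / 2 * ((36 * (d : ℝ) * (frameC d L + d)) * (L : ℝ) ^ (j + 1) * (cRE * b₀))) * ((36 * (d : ℝ) * (frameC d L + d)) * (L : ℝ) ^ (j + 1))
        + 14 * d * ((36 * (d : ℝ) * (frameC d L + d)) * (L : ℝ) ^ (j + 1)) ^ 2 * (cRE * b₀)) ≤ 1 / 2)
    -- E′'s radii named: `α_E` (sup radius of `Z`), `θ_u` (sup radius of `u − 1`); road (B)'s regime `α_E ≤ 1∕40`, `θ_u ≤ 1∕160`, and `α₀ ≥ α_E + 4θ_u + 4(6θ_u)(α_E + 4θ_u)`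
    {αE θu : ℝ} (hαE : αE = 2 * (r₀ + 5 / 2 * ((36 * (d : ℝ) * (frameC d L + d)) * (L : ℝ) ^ (j + 1) * (cRE * b₀))))
    (hθu : θu = 4 * ((36 * (d : ℝ) * (frameC d L + d) ^ 2) * ((L : ℝ) ^ (j + 1)) ^ 2 * (cRE * b₀)))
    (hαE40 : αE ≤ 1 / 40) (hθu160 : θu ≤ 1 / 160)
    (hα₀ : αE + 4 * θu + 4 * (2 * θu + 4 * θu) * (αE + 4 * θu) ≤ α₀)
    -- the remaining analytic letters at `W`: (L1)′ and α₁ for the SAME-TOP structured fields of radius `α₀`, (L2), (L3) discharged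
    -- (L1)′ DISCHARGED (F111): the quadratic-remainder regime, the slice `S` containing the `W`-tangent skew periodic fields, and the names `c_N = 4m`, `ν = 24·#Plane·m`
    (hs1 : LevelSmall d L (j + 1) x) (hA : curvSum d L (j + 1) x ≤ 2 / 3 * L) (hσ0 : 4 * (3 + 12 * (d : ℝ)) ^ 2 * (L : ℝ) ^ (j + 1) * α₀ ≤ rho0 d L ^ 2)
    (S : Set (Site d → Fin d → Matrix n n ℂ))
    (hS : ∀ X : Site d → Fin d → Matrix n n ℂ, IsSkewDir X → IsPeriodicDir X ((N * L ^ (j + 1) : ℕ) : ℤ) → dirIter L (j + 1) W X = 0 → X ∈ S)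
    {cN aN KG KX ν : ℝ} (haN : aN = (supC d L / ((L : ℝ) ^ (j + 1) * (1 - cruxC d L * (((L : ℝ) ^ (j + 1)) ^ 2 * x)))
        * (4 * (3 + 12 * (d : ℝ)) ^ 3 / rho0 d L ^ 2 * ((L : ℝ) ^ (j + 1) * α₀) ^ 2)))
    (hcN : cN = 4 * (supC d L / ((L : ℝ) ^ (j + 1) * (1 - cruxC d L * (((L : ℝ) ^ (j + 1)) ^ 2 * x)))
        * (4 * (3 + 12 * (d : ℝ)) ^ 3 / rho0 d L ^ 2 * ((L : ℝ) ^ (j + 1) * α₀) ^ 2)))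
    (hνm : ν = 24 * (Fintype.card (T4AveragingDeficitWall.Plane d) : ℝ) * (supC d L / ((L : ℝ) ^ (j + 1) * (1 - cruxC d L * (((L : ℝ) ^ (j + 1)) ^ 2 * x)))
        * (4 * (3 + 12 * (d : ℝ)) ^ 3 / rho0 d L ^ 2 * ((L : ℝ) ^ (j + 1) * α₀) ^ 2)))
    {α₁ : ℝ} (hα1 : 0 ≤ α₁)
    (hGrad : ∀ (Z : Site d → Fin d → Matrix n n ℂ) (σ : Site d → Matrix n n ℂ) (Z' : Site d → Fin d → Matrix n n ℂ),
      IsSkewDir Z → IsPeriodicDir Z ((N * L ^ (j + 1) : ℕ) : ℤ) → IsLandauB8 (d := d) L N (j + 1) W Z → (∀ y μ, ‖Z y μ‖ ≤ αE) →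
      (∀ y, σ y ∈ skewAdjoint (Matrix n n ℂ)) → (∀ (y : Site d) (i : Fin d), σ (y + ((N * L ^ (j + 1) : ℕ) : ℤ) • e i) = σ y) →
      (∀ y, ‖σ y‖ ≤ 2 * θu) → (∀ (y : Site d) (κ : Fin d), ‖gaugeDir W σ y κ‖ ≤ 4 * θu) →
      IsSkewDir Z' → IsPeriodicDir Z' ((N * L ^ (j + 1) : ℕ) : ℤ) →
      (∀ y μ, ‖Z' y μ‖ ≤ α₀) → cavgIter L (j + 1) (vary W Z' 1) = cavgIter L (j + 1) W →
      (∀ (y : Site d) (μ : Fin d), ‖Z' y μ - (Z y μ - gaugeDir W σ y μ)‖ ≤ 4 * (2 * θu + 4 * θu) * (αE + 4 * θu)) →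
      ∀ (y : Site d) (κ τ : Fin d), ‖Ad (W (y + e κ) τ) (Z' (y + e τ) κ) - Z' y κ‖ ≤ α₁)
    (hG : ∀ X ∈ S, IsPeriodicDir X ((N * L ^ (j + 1) : ℕ) : ℤ) → dirIter L (j + 1) W X = 0 → ∀ R : ℝ, (∀ y κ', ‖X y κ'‖ ≤ R) → ∀ g : ℝ, 0 ≤ g →
      (∀ Y : Site d → Fin d → Matrix n n ℂ, IsSkewDir Y → IsPeriodicDir Y ((N * L ^ (j + 1) : ℕ) : ℤ) → dirIter L (j + 1) W Y = 0 →
        |hess W X Y (perWin d (N * L ^ (j + 1)))| ≤ g * dirL1 Y (periodBox (d := d) (N * L ^ (j + 1)))) →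
      ∀ z μ' ν', μ' ≠ ν' → ‖curlAt W X z μ' ν'‖ ≤ KG * g + KX * R)
    (hcritW : ∀ Y : Site d → Fin d → Matrix n n ℂ, IsSkewDir Y → IsPeriodicDir Y ((N * L ^ (j + 1) : ℕ) : ℤ) → dirIter L (j + 1) W Y = 0 →
      dAction W Y (perWin d (N * L ^ (j + 1))) = 0) :
    SmallField U (x + (KG * (
        ((x + 4 * (Real.exp α₀ - 1))
            * ((curl1C d L / (1 - thetaLoc d L * (((L : ℝ) ^ (j + 1)) ^ 2 * (x + 4 * (Real.exp α₀ - 1)))))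
                * (((L : ℝ) ^ (j + 1)) ^ d / ((L : ℝ) ^ (j + 1)) ^ 2))
            * (Real.exp (((L : ℝ) ^ d / L) * ((d : ℝ) * (16 * ((d : ℝ) + 1) * ((d : ℝ) + 4) * (L : ℝ) ^ 2)
                  * (1250 * ((nbRad d L : ℝ) + L) + 8 * ((d : ℝ) * L) + 2 * L)) * (2 / twoLevelSmall d L))
                * ((L : ℝ) / (L : ℝ) ^ d) ^ j
                * (((d : ℝ) * (2 * nbRad d L + 1) ^ d) * ((2 * (d : ℝ) + 4) * (L : ℝ) ^ 2) * (2 * (L : ℝ) ^ j) * (Real.exp α₀ - 1)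
                  + (17 / 8 * ((L : ℝ) ^ 2) ^ j * (x + 4 * (Real.exp α₀ - 1)))
                    * (((d : ℝ) * (2 * nbRad d L + 1) ^ d) * ((2 * (d : ℝ) + 4)
                          * (2 * (2 * L * (nbRad d L : ℝ) + 128 * ((d : ℝ) + 1) * ((d : ℝ) + 4) * (L : ℝ) ^ 2)))
                      + ((d : ℝ) * (2 * nbRad d L + 1) ^ d) * ((2 * (d : ℝ) + 4) * (L : ℝ) ^ 2 * (2 * (nbRad d L : ℝ))
                          + 2 * (8 * (L : ℝ) + (1250 * ((nbRad d L : ℝ) + L) + 8 * (d * L) + 2 * L))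
                              * (16 * ((d : ℝ) + 1) * ((d : ℝ) + 4) * (L : ℝ) ^ 2))))))
        + (Fintype.card (T4AveragingDeficitWall.Plane d) : ℝ)
          * (2 * (240 * (Real.exp α₀ - 1) * α₀ * (2 * α₁ + 24 * α₀ * (Real.exp α₀ - 1) + x) + 8 * α₀ * (2 * α₁ + 24 * α₀ * (Real.exp α₀ - 1))
              + 6 * (Real.exp α₀ - 1) * (2 * α₁ + 24 * (Real.exp α₀ - 1) * α₀)
              + (2 * α₁ + 24 * (Real.exp α₀ - 1) * α₀) * (2 * α₁ + 24 * α₀ * (Real.exp α₀ - 1))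
              + 960 * (Real.exp α₀ - 1) * α₀ ^ 2 + 32 * x * α₀ ^ 2)
            + (64 * α₀ * α₁ + 1024 * x * α₀ ^ 2))
        + ν) + KX * (α₀ + aN) + cN + 28 * α₀ ^ 2)) := by
  -- the right-inverse regime at `x` from the one at `x′ = x + 4(e^{α₀} − 1) ≥ x`
  have hexp : 0 ≤ 4 * (Real.exp α₀ - 1) := by have := Real.add_one_le_exp α₀; linarith
  have hM2 : 0 ≤ ((L : ℝ) ^ (j + 1)) ^ 2 := by positivity
  have hxx' : ((L : ℝ) ^ (j + 1)) ^ 2 * x ≤ ((L : ℝ) ^ (j + 1)) ^ 2 * (x + 4 * (Real.exp α₀ - 1)) :=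
    mul_le_mul_of_nonneg_left (by linarith) hM2
  have hθx : cruxC d L * (((L : ℝ) ^ (j + 1)) ^ 2 * x) < 1 :=
    (mul_le_mul_of_nonneg_left hxx' (cruxC_nonneg d L)).trans_lt hθ
  have hεx : ((L : ℝ) ^ (j + 1)) ^ 2 * x ≤ 1 := hxx'.trans hε
  -- `m ≥ 0`, hence `ν ≥ 0`
  have h1θ : 0 < 1 - cruxC d L * (((L : ℝ) ^ (j + 1)) ^ 2 * x) := by linarith
  have hsupC0 : 0 ≤ supC d L := by
    unfold supC NE3RightInverseSupLetters.corrC NE3RightInverseSupLetters.frameC; have := NE3QbarIterCovLiftPrep.liftC_nonneg d; positivity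
  have hν : 0 ≤ ν := by rw [hνm]; positivity
  refine smallField_of_tanCritical_roadB hd hL j hWu hWP hx hs hWx hα0 hs' hθ hθl hε hUu hUP hxU hsU hUxU hcritU hTopUW hx10 hgrad hbx hcx hbx' hcx'
    hr₀ hb₀ hcRE hreg₁ hreg₂ hreg₃ hline hαE hθu hαE40 hθu160 hα₀ S hν ?_ hα1 hGrad hG hcritW
  -- (L1)′ by F111
  intro Z σ Z' _ _ _ _ _ _ _ _ hZ's hZ'P hZ'α hTop _
  obtain ⟨AN, hANs, hANP, hANex, hANsup, hANcurl, hANhess⟩ :=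
    exists_normalLift_sameTop hL j hWu hWP hx hs hs1 hWx hθx hεx hA hZ's hZ'P hα0 hZ'α hσ0 hTop
  refine ⟨AN, hANP, fun y μ => ?_, hANex, fun z μ' ν' hne => ?_, fun Y _ hYP _ => ?_, hS _ (fun y μ => (skewAdjoint _).sub_mem (hZ's y μ) (hANs y μ)) ?_ ?_⟩
  · rw [haN]; exact hANsup y μ
  · rw [hcN]; exact hANcurl z μ' ν' hne
  · rw [hνm]; exact hANhess Y hYP
  · intro y κ μ
    show Z' (y + _) μ - AN (y + _) μ = Z' y μ - AN y μ
    rw [hZ'P y κ μ, hANP y κ μ]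
  · rw [dirIter_sub (by omega) j hWu hx hs hWx Z' AN, hANex]
    funext z κ
    exact sub_self _

end

end Summit.QuantumFields.BalabanUV.T4Continuum.NE7ApeCurvedRepRoadBLiftedH
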